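import Literature.NumberTheory.EllipticCurves.CongruentNumberMonskySelmerParityAnalytic
import Literature.NumberTheory.EllipticCurves.BSDSelmerParityMonskyProofs
import Literature.NumberTheory.EllipticCurves.BSDSelmerParityDokchitserProofs
import HarnessLib

/-!
# Monsky's parity theorem for `s(D)` — part 7: the `2`-parity conjecture for `E_D` in corank form, granting Cassels–Tate only

The tree's named fact `monsky_selmerCorank_two_mod_two_eq` (Dokchitser–Dokchitser, Ann. of Math. 172
(2010), proof of Thm. 4.19, case `p = 2`: "For `p = 2` this is due to Monsky [26]", [26] = Monsky,
Math. Z. 221 (1996) Thm. 1.5) says: for every elliptic `E/ℚ`,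
`corank_{ℤ₂} Sel_{2^∞}(E/ℚ) ≡ ord_{s=1} L(E, s) (mod 2)`.  Its discharges in the tree
(`BSDSelmerParityMonskyProofs`, `…HoffsteinLuoProofs`) go through modularity, Hoffstein–Luo,
Gross–Zagier–Kolyvagin, Kramer's parity lemma and the Cassels–Tate pairing.  For the congruent
number curves `E_n : y² = x³ − n²x` (`n` square-free) Monsky's ELEMENTARY route — the appendix to
Heath-Brown, Invent. Math. 118 (1994) [HeathBrown1994SelmerCongruentII], formalised in parts 1–6 of this
series — gives the same congruence **granting the Cassels–Tate pairing alone**: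

* Monsky's parity theorem + the complete `2`-descent: `#Sel⁽²⁾(E_n/ℚ) = 2^{2+s}`, `s` even iff
  `n ≡ 1, 2, 3 (mod 8)` (part 5, `exists_card_selmerGroup_two_eq_pow`), and `#Ш(E_n)[2]·2^{rk} = 2^{s}`
  (`natCard_sha_two_mul_pow_rank_eq`), so `s = rk + dim Ш[2]` is Monsky-1996's `s₂(E_n, ℚ)`;
* Cassels–Tate (`hCT`): `dim Ш[2] ≡ corank Ш[2^∞] (mod 2)`, whence `s ≡ rk + corank Ш[2^∞] =
  corank Sel_{2^∞}` (tree: `mordellWeilRank_add_mod_two_eq_selmerCorank_of_casselsTate`,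
  `BSDSelmerParityMonskyProofs`, with Greenberg's `selmerCorank_eq_mordellWeilRank_add_holds`);
* Koblitz's CM functional equation: `ord_{s=1} L(E_n, s)` is even iff `n ≡ 1, 2, 3 (mod 8)` (part 6,
  `even_analyticRank_congruentNumberCurve_iff`).

## What is here (all PROVED; no definitions, no named facts)

* `selmerCorank_two_mod_two_eq_of_casselsTate` — for square-free `n`, granting `hCT`:
  `corank_{ℤ₂} Sel_{2^∞}(E_n/ℚ) % 2 = [n ≡ 5, 6, 7 (mod 8)]`;
* **`selmerCorank_two_mod_two_eq_analyticRank_of_casselsTate`** — for square-free `n`, granting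
  `hCT`: `(E_n).selmerCorank 2 % 2 = (E_n).analyticRank % 2`, i.e. the named fact
  `monsky_selmerCorank_two_mod_two_eq` ON THE CONGRUENT NUMBER FAMILY
  (`selmerCorank_mod_two_eq (congruentNumberCurve n) 2`), modulo bsd.S18 only.

Cell `bsd-monsky` (prover-B).  AI provenance: written by an AI assistant; no human has reviewed it.

## References

* [HeathBrown1994SelmerCongruentII] Heath-Brown 1994, §1 typescript p. 3 L13–L24; Appendix (Monsky)
  p. 38 L5–L16.
* [Monsky1996] P. Monsky, *Generalizing the Birch–Stephens theorem. I*, Math. Z. 221 (1996), p. 415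
  (`s_l`), p. 416 (proof of Lemma 1.2), Thm. 1.5.
* [DokchitserDokchitserAnnals2010] T. and V. Dokchitser, Ann. of Math. 172 (2010), §4.6, proof of
  Thm. 4.19 (case `p = 2`).
* [KoblitzECMF1993] N. Koblitz, GTM 97, Ch. II §5, Theorem (p. 84).
-/

noncomputable section

open WeierstrassCurve
open Literature.NumberTheory.EllipticCurves.HeathBrown1994

namespace Literature.NumberTheory.EllipticCurves

namespace MonskySelmerParity

/-- `#Ш(E_N)[2] = 2^{s − rk}` in the currency `Nat.card ((E_N).sha)[2]` of `BSDSelmerParityMonskyProofs`: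
from `#(Ш ⊓ H¹[2])·2^{rk} = 2^{s}` (`natCard_sha_two_mul_pow_rank_eq`) and `#(Ш[2]) = #(Ш ⊓ H¹[2])`
(`Literature.Algebra.Module.natCard_torsionBy_addSubgroup`). [cite: SilvermanAEC2009, Thm. X.4.2]
[cite: HeathBrown1994SelmerCongruentII, §1 typescript p. 1 L14–L20] -/
theorem natCard_shaTorsionBy_two_eq_pow {N : ℕ} (hN : N ≠ 0) {s : ℕ}
    (hs : Nat.card ((congruentNumberCurve N).selmerGroup 2) = 2 ^ (2 + s)) :
    haveI := isElliptic_congruentNumberCurve hN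
    (congruentNumberCurve N).mordellWeilRank ≤ s ∧
      Nat.card (AddSubgroup.torsionBy (congruentNumberCurve N).sha (2 : ℤ)) =
        2 ^ (s - (congruentNumberCurve N).mordellWeilRank) := by
  haveI := isElliptic_congruentNumberCurve hN
  have h := natCard_sha_two_mul_pow_rank_eq hN hs
  have hle : (congruentNumberCurve N).mordellWeilRank ≤ s :=
    (CongruentNumberMonskySelmer.mordellWeilRank_le_of_card_selmerGroup_two_le hN hs.le).1
  refine ⟨hle, ?_⟩
  rw [Literature.Algebra.Module.natCard_torsionBy_addSubgroup]
  have hpow : (2 : ℕ) ^ s = 2 ^ (s - (congruentNumberCurve N).mordellWeilRank) *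
      2 ^ (congruentNumberCurve N).mordellWeilRank := by
    rw [← pow_add, Nat.sub_add_cancel hle]
  rw [hpow] at h
  exact Nat.eq_of_mul_eq_mul_right (pow_pos (by norm_num) _) h

/-- **`corank_{ℤ₂} Sel_{2^∞}(E_n/ℚ) ≡ [n ≡ 5, 6, 7 (mod 8)] (mod 2)` for square-free `n`, granting the
Cassels–Tate pairing** (`hCT`, bsd.S18): Monsky's `s(n) = rk + dim Ш[2]` has the parity of
`rk + corank Ш[2^∞] = corank Sel_{2^∞}` (`mordellWeilRank_add_mod_two_eq_selmerCorank_of_casselsTate`),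
and `s(n)` is even iff `n ≡ 1, 2, 3 (mod 8)` (Monsky's parity theorem).
[cite: HeathBrown1994SelmerCongruentII, §1 typescript p. 3 L13–L24; Appendix (Monsky) p. 38 L5–L7]
[cite: Monsky1996, p. 416 (proof of Lemma 1.2)] -/
theorem selmerCorank_two_mod_two_eq_of_casselsTate {n : ℕ} (hsq : Squarefree n)
    (hCT : exists_casselsTate_pairing (K := ℚ)) :
    haveI := isElliptic_congruentNumberCurve hsq.ne_zero
    (congruentNumberCurve n).selmerCorank 2 % 2 = if n % 8 = 1 ∨ n % 8 = 2 ∨ n % 8 = 3 then 0 else 1 := by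
  haveI := isElliptic_congruentNumberCurve hsq.ne_zero
  haveI : Fact (Nat.Prime 2) := ⟨Nat.prime_two⟩
  obtain ⟨s, hs, -, hpar⟩ := exists_card_selmerGroup_two_eq_pow hsq
  obtain ⟨hle, hu⟩ := natCard_shaTorsionBy_two_eq_pow hsq.ne_zero hs
  have hu' : Nat.card (AddSubgroup.torsionBy (congruentNumberCurve n).sha ((2 : ℕ) : ℤ)) =
      2 ^ (s - (congruentNumberCurve n).mordellWeilRank) := by
    simpa only [Nat.cast_ofNat] using hu
  have h := mordellWeilRank_add_mod_two_eq_selmerCorank_of_casselsTate hCT (congruentNumberCurve n) 2 hu'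
  rw [Nat.add_sub_cancel' hle] at h
  rw [← h]
  by_cases h8 : n % 8 = 1 ∨ n % 8 = 2 ∨ n % 8 = 3
  · rw [if_pos h8]
    exact Nat.even_iff.mp (hpar.mpr h8)
  · rw [if_neg h8]
    exact Nat.odd_iff.mp (Nat.not_even_iff_odd.mp fun he => h8 (hpar.mp he))

/-- **The `2`-parity conjecture for the congruent number curves, corank form, granting Cassels–Tate
only**: for every square-free `n`, `corank_{ℤ₂} Sel_{2^∞}(E_n/ℚ) ≡ ord_{s=1} L(E_n, s) (mod 2)` —
both sides are `[n ≡ 5, 6, 7 (mod 8)]` (Monsky's parity theorem with the Cassels–Tate parity on one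
side, Koblitz's CM sign on the other).  This is the named fact `monsky_selmerCorank_two_mod_two_eq`
(Dokchitser–Dokchitser 2010, proof of Thm. 4.19 at `p = 2`; Monsky 1996 Thm. 1.5) restricted to the
family `E_n`, modulo bsd.S18 alone. [cite: DokchitserDokchitserAnnals2010, §4.6, proof of Thm. 4.19 (case p = 2)]
[cite: HeathBrown1994SelmerCongruentII, §1 typescript p. 3 L13–L24] [cite: KoblitzECMF1993, Ch. II §5, Theorem (p. 84)] -/
theorem selmerCorank_two_mod_two_eq_analyticRank_of_casselsTate {n : ℕ} (hsq : Squarefree n)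
    (hCT : exists_casselsTate_pairing (K := ℚ)) :
    haveI := isElliptic_congruentNumberCurve hsq.ne_zero
    (congruentNumberCurve n).selmerCorank 2 % 2 = (congruentNumberCurve n).analyticRank % 2 := by
  haveI := isElliptic_congruentNumberCurve hsq.ne_zero
  rw [selmerCorank_two_mod_two_eq_of_casselsTate hsq hCT]
  have hpar := even_analyticRank_congruentNumberCurve_iff hsq
  by_cases h8 : n % 8 = 1 ∨ n % 8 = 2 ∨ n % 8 = 3
  · rw [if_pos h8]
    exact (Nat.even_iff.mp (hpar.mpr h8)).symm
  · rw [if_neg h8]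
    exact (Nat.odd_iff.mp (Nat.not_even_iff_odd.mp fun he => h8 (hpar.mp he))).symm

/-- The same, in the vocabulary of the named fact: `selmerCorank_mod_two_eq (congruentNumberCurve n) 2`
granting Cassels–Tate. [cite: DokchitserDokchitserAnnals2010, §4.6, proof of Thm. 4.19 (case p = 2)] -/
theorem selmerCorank_mod_two_eq_two_congruentNumberCurve_of_casselsTate {n : ℕ} (hsq : Squarefree n)
    (hCT : exists_casselsTate_pairing (K := ℚ)) :
    haveI := isElliptic_congruentNumberCurve hsq.ne_zero
    selmerCorank_mod_two_eq (congruentNumberCurve n) 2 := by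
  haveI := isElliptic_congruentNumberCurve hsq.ne_zero
  exact selmerCorank_two_mod_two_eq_analyticRank_of_casselsTate hsq hCT

end MonskySelmerParity

end Literature.NumberTheory.EllipticCurves

end
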